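import Mathlib
import HarnessLib
import Literature.Analysis.FluidPDE.TypeIAncientMild
import Literature.Analysis.FluidPDE.LocalTypeI
import Literature.Analysis.FluidPDE.LocalTypeILiouville
import Summits.NavierStokesRegularity.NavierStokesRegularity.Theses.DulacContraction
import Summits.NavierStokesRegularity.NavierStokesRegularity.Theorems.SymmetryModuliCountForcedSymmetryClassEquivalence
import Summits.NavierStokesRegularity.NavierStokesRegularity.Theorems.SymmetryModuliCountForcedSymmetryRdssLiouvilleTauReduction
import Summits.NavierStokesRegularity.NavierStokesRegularity.Theorems.ExtremalTypeIConstantExtremalSpiralSymmetryPeriodToRDSS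

/-!
# Crux `ExtremalSpiralSymmetry` (stmt-NavierStokesRegularity-8215), line `registered`, stub 2b — converse bridge:
# the gauge-class wall `stub_rdssLiouville` IMPLIES crux `RDSSLiouvilleInClass` (stmt-8561); so the two are EQUIVALENT

Support file (theorems only, `--supports stmt-NavierStokesRegularity-8215`; no definitions, no named facts). Lead c2.

The companion file `…RdssLiouvilleOfInClass.lean` proved `RDSSLiouvilleInClass → stub_rdssLiouville`. Here the converse:
`rdssLiouvilleInClass_of_rdssLiouville : stub_rdssLiouville → RDSSLiouvilleInClass` (both statements verbatim; the
stub as an explicit hypothesis). Hence the registered wall of this line — "every element of the KNSS-gauge class `A_C`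
which is `(c, R)`-rotated-discretely-self-similar about some `(0, x₀)` on `t < 0` with `c > 1` vanishes on `t < 0`", a
statement with NO pressure, NO local-energy bookkeeping and NO measure theory — is kernel-checked EQUIVALENT to the
crux stmt-8561 of route `DulacContraction` (Albritton–Barker's slab class `𝒦`, invariance a.e. under one similarity
with `l > 1`, `τ ≤ 0` ⇒ the origin is regular).

Proof (the known class bridge `𝒦 ⊂ A_C` a.e., as in `stub_centredWall_of_typeIDSSLiouvilleConjecture`): the case
`τ < 0` is elementary (`not_isBackwardSingularPoint_of_rdssInvariant_of_neg`: the rate bound transported along the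
similarity bounds `w` on the slab). For `τ = 0`: `w` equals an element `v ∈ A_C` everywhere on the open slab
(`exists_isTypeIAncientMild_repr_of_slabProfile` + continuity, `Measure.eqOn_open_of_ae_eq`); the a.e. invariance is
pointwise for the classical `w` (`rdssInvariant_pointwise_of_classical`), hence for `v`; the similarity
`x ↦ lRx + ξ` has a centre `x₀ = lRx₀ + ξ` (`exists_centre_of_period`), about which the invariance is exactly the
RDSS identity of the stub; the stub makes `v ≡ 0` on `t < 0`, so `w = 0` on the open slab, hence a.e. on `Q_1(0,0)`,
and the origin is not a backward singular point.

References: D. Albritton, T. Barker, J. Math. Fluid Mech. 21 (2019) = arXiv:1811.00502, Thm 1.1, §3 [AlbrittonBarker2019];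
G. Koch, N. Nadirashvili, G. Seregin, V. Šverák, Acta Math. 203 (2009), Lemma 3.1, Prop. 4.1
[KochNadirashviliSereginSverak2009]; Z. Bradshaw, T.-P. Tsai, Comm. PDE 42 (2017), §5 OP 5.1 [BradshawTsai2017CPDE].
-/

noncomputable section

-- the summit and its single sub-problem share the name (CONVENTIONS §1), as in every Theorems file
set_option linter.dupNamespace false

open Set MeasureTheory Filter Topology Function
open scoped ENNReal
open Literature.Analysis.FluidPDE

namespace Summit.NavierStokesRegularity.NavierStokesRegularity.Theorems.ExtremalSpiralSymmetry.Registered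

/-- **Centre of the similarity `x ↦ lRx + ξ`.** For `l > 0`, `l ≠ 1` and a linear isometry `R` there is `x₀` with
`x₀ = l • R x₀ + ξ` (from `exists_centre_of_period` applied to `l⁻¹ ξ`). [folklore] -/
theorem exists_fixedPoint_of_similarity {l : ℝ} (hl : 0 < l) (hl1 : l ≠ 1)
    (R : EuclideanSpace ℝ (Fin 3) ≃ₗᵢ[ℝ] EuclideanSpace ℝ (Fin 3)) (ξ : EuclideanSpace ℝ (Fin 3)) :
    ∃ x₀ : EuclideanSpace ℝ (Fin 3), l • R x₀ + ξ = x₀ := by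
  obtain ⟨x₀, hx₀⟩ := exists_centre_of_period hl hl1 R (l⁻¹ • ξ)
  refine ⟨x₀, ?_⟩
  have h := congrArg (fun z => l • z) hx₀
  simp only [smul_sub, smul_smul, mul_inv_cancel₀ hl.ne', one_smul] at h
  -- `h : x₀ - l • R x₀ = ξ`
  rw [← h]
  abel

/-- **`stub_rdssLiouville → RDSSLiouvilleInClass` (stmt-8561): the gauge-class RDSS wall implies the slab-class crux.**
Assume the registered wall of the line (hypothesis, statement verbatim): every `u ∈ A_C` which is `(c, R)`-RDSS about
some `(0, x₀)` on `t < 0` with `c > 1` vanishes on `t < 0`. Then `DulacContraction.RDSSLiouvilleInClass` holds: a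
smooth slab profile `(w, q, H)` of Albritton–Barker's class with the rate which is invariant a.e. on the slab under
`(t, x) ↦ l • R⁻¹ w(l²t + τ, lRx + ξ)`, `l > 1`, `τ ≤ 0`, is regular at the origin — for `τ < 0` by the transported
rate bound, for `τ = 0` because `w` agrees on the open slab with an element of `A_C` which is then RDSS about the
centre `x₀ = lRx₀ + ξ` pointwise, hence zero by the wall. Together with `stub_rdssLiouville_of_rdssLiouvilleInClass`:
the two statements are EQUIVALENT. [cite: AlbrittonBarker2019, Thm 1.1 and §3] -/
theorem rdssLiouvilleInClass_of_rdssLiouville :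
    (∀ (C : ℝ) (u : ℝ → EuclideanSpace ℝ (Fin 3) → EuclideanSpace ℝ (Fin 3)) (c : ℝ)
      (R : EuclideanSpace ℝ (Fin 3) ≃ₗᵢ[ℝ] EuclideanSpace ℝ (Fin 3)) (x₀ : EuclideanSpace ℝ (Fin 3)),
      (ContDiffOn ℝ (⊤ : ℕ∞) (Function.uncurry u) (Set.Iio 0 ×ˢ Set.univ) ∧
          (∀ t < 0, Literature.Analysis.FluidPDE.VectorCalculus.IsDivFree (u t)) ∧
          (∀ s t : ℝ, s < t → t < 0 → ∀ x, u t x =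
            Literature.Analysis.FluidPDE.heatFlow (u s) (t - s) x -
              ∫ τ in Set.Ioo s t, ∫ y,
                Literature.Analysis.FluidPDE.oseenKernel (t - τ) (x - y) (u τ y) (u τ y)) ∧
          Literature.Analysis.FluidPDE.HasTypeITimeDecay C u) →
      1 < c →
      (∀ t < (0 : ℝ), ∀ y, c • R.symm (u (c ^ 2 * t) (x₀ + c • R y)) = u t (x₀ + y)) →
      ∀ t < (0 : ℝ), ∀ x, u t x = 0) →
    _root_.Summit.NavierStokesRegularity.NavierStokesRegularity.Theses.DulacContraction.RDSSLiouvilleInClass := by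
  intro hW
  dsimp only [Summit.NavierStokesRegularity.NavierStokesRegularity.Theses.DulacContraction.RDSSLiouvilleInClass]
  intro w q H C hsw _hwg hI hdec hcl hsim
  obtain ⟨l, hl, R, ξ, τ, hτ, hinv⟩ := hsim
  have hl0 : 0 < l := zero_lt_one.trans hl
  rcases lt_or_eq_of_le hτ with hτneg | hτ0
  · -- `τ < 0`: elementary
    exact Summit.NavierStokesRegularity.NavierStokesRegularity.Theorems.SymmetryModuliCountForcedSymmetry.not_isBackwardSingularPoint_of_rdssInvariant_of_neg
      R ξ hdec hl hτneg hinv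
  · -- `τ = 0`: the class bridge
    subst hτ0
    have hneg : ∀ t < (0 : ℝ), l ^ 2 * t < 0 := fun t ht => mul_neg_of_pos_of_neg (by positivity) ht
    have hSm : MeasurableSet (Iio (0 : ℝ) ×ˢ (univ : Set (EuclideanSpace ℝ (Fin 3)))) :=
      measurableSet_Iio.prod MeasurableSet.univ
    have hS : IsOpen (Iio (0 : ℝ) ×ˢ (univ : Set (EuclideanSpace ℝ (Fin 3)))) := isOpen_Iio.prod isOpen_univ
    -- Step 1: an `A_C` representative `v`, equal to `w` everywhere on the open slab
    obtain ⟨v, hv, hae⟩ :=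
      Summit.NavierStokesRegularity.NavierStokesRegularity.Theorems.SymmetryModuliCountForcedSymmetry.exists_isTypeIAncientMild_repr_of_slabProfile
        hsw hdec hI
    have hwv : EqOn (uncurry w) (uncurry v) (Iio (0 : ℝ) ×ˢ (univ : Set (EuclideanSpace ℝ (Fin 3)))) :=
      Measure.eqOn_open_of_ae_eq hae hS hcl.smooth_velocity.continuousOn hv.continuousOn_uncurry
    have hwv' : ∀ t < (0 : ℝ), ∀ x : EuclideanSpace ℝ (Fin 3), w t x = v t x := fun t ht x =>
      hwv (show ((t, x) : ℝ × EuclideanSpace ℝ (Fin 3)) ∈ Iio (0 : ℝ) ×ˢ (univ : Set (EuclideanSpace ℝ (Fin 3)))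
        from ⟨ht, mem_univ _⟩)
    -- Step 2: the a.e. clause is pointwise on `t < 0` for the classical `w`
    have hptw : ∀ t < (0 : ℝ), ∀ x : EuclideanSpace ℝ (Fin 3),
        l • R.symm (w (l ^ 2 * t + 0) (l • R x + ξ)) = w t x :=
      Summit.NavierStokesRegularity.NavierStokesRegularity.Theorems.SymmetryModuliCountForcedSymmetry.rdssInvariant_pointwise_of_classical
        R ξ hcl hl0 le_rfl hinv
    -- Step 3: centre the similarity and pass to `v`
    obtain ⟨x₀, hx₀⟩ := exists_fixedPoint_of_similarity hl0 hl.ne' R ξ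
    have hptv : ∀ t < (0 : ℝ), ∀ y : EuclideanSpace ℝ (Fin 3),
        l • R.symm (v (l ^ 2 * t) (x₀ + l • R y)) = v t (x₀ + y) := by
      intro t ht y
      have key := hptw t ht (x₀ + y)
      have e1 : l • R (x₀ + y) + ξ = x₀ + l • R y := by
        rw [map_add, smul_add, add_assoc, add_comm (l • R y) ξ, ← add_assoc, hx₀]
      rw [add_zero, e1, hwv' _ (hneg t ht), hwv' t ht] at key
      exact key
    -- Step 4: the wall kills `v`, hence `w`, on the slab
    have hv0 : ∀ t < (0 : ℝ), ∀ x, v t x = 0 := hW C v l R x₀ (isTypeIAncientMild_iff.1 hv) hl hptv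
    have hw0 : ∀ t < (0 : ℝ), ∀ x : EuclideanSpace ℝ (Fin 3), w t x = 0 := fun t ht x => by
      rw [hwv' t ht x, hv0 t ht x]
    intro hsing
    have hzero : ∀ᵐ z ∂(volume.restrict (Iio (0 : ℝ) ×ˢ (univ : Set (EuclideanSpace ℝ (Fin 3))))),
        uncurry w z = (0 : ℝ × EuclideanSpace ℝ (Fin 3) → EuclideanSpace ℝ (Fin 3)) z := by
      filter_upwards [ae_restrict_mem hSm] with z hz
      exact hw0 z.1 hz.1 z.2
    have hsub : parabolicCylinder 1 (0 : ℝ × EuclideanSpace ℝ (Fin 3)) ⊆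
        Iio (0 : ℝ) ×ˢ (univ : Set (EuclideanSpace ℝ (Fin 3))) :=
      parabolicCylinder_origin_subset_slab 1
    have h1 := hsing 1 one_pos
    rw [eLpNorm_congr_ae (ae_restrict_of_ae_restrict_of_subset hsub hzero), eLpNorm_zero] at h1
    exact ENNReal.zero_ne_top h1

end Summit.NavierStokesRegularity.NavierStokesRegularity.Theorems.ExtremalSpiralSymmetry.Registered

end
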